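import Mathlib
import HarnessLib
import Summits.HubbardSuperconductivity.HubbardSuperconductivity.Theorems.KLProgrammeKLRegimeEngineTowerKitUnits
import Summits.HubbardSuperconductivity.HubbardSuperconductivity.Theorems.KLProgrammeKLRegimeEngineTowerScalingLip

/-!
# Route `KLProgramme` — crux K3 ENGINE (stmt-HubbardSuperconductivity-20437 `KLRegimeEngineV17F2`), stub (e) rows C1/C2 «(e)-C ⇐ (b)-TWOVOL»:
# UNITS for the LIPSCHITZ step right side — the polarised twin of E1's (I1-dim) third brick `…EngineTowerKitUnits`
# (cell gate-hubbard-kl, seat hubbard-kl-k3c5-p2 g9)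

E1's `…EngineTowerKitUnits` divides the kit's ONE-input step right side in absolute sizes `B(m) = K·u^m·b(m)` by the output unit `u^p·K` and obtains the same right
side in the dimensionless sizes `b` with `(σ̂, τ̂, Φ̂, ψ̂) = (σu, τu, ΦK, ψ/u)`.  The Lipschitz tower (`towerLipStep_le_of_chernoff`, `towerBornDiff_le_law₄`, p559494)
reads the MIXED graded sum `towerSLip D τ ν μ n p` (one slot the difference profile `ν`, the others the common majorant `μ`), a first order in `ν`, and `Ct` tails
of `μ`; both profiles live in the SAME units (`Bν = K·u^m·bν`, `Bμ = K·u^m·bμ`), so the same division applies: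

* `towerSLip_const_mul`, `towerSLip_units` — `towerSLip D τ (K u^· bν) (K u^· bμ) n p = Kⁿ·towerSLip D (τu) bν bμ n p` (with `towerSLip_pow_mul`, p562385);
* **`kitGradedLip_units`** — `(Σ_{n∈Icc 2 N} e·Φ^{n−1}·ψ^p·towerSLip D τ Bν Bμ n p)/(u^p·K) = Σ_{n∈Icc 2 N} e·Φ̂^{n−1}·ψ̂^p·towerSLip D τ̂ bν bμ n p`;
* **`kitStepLip_units`** — first order (in `Bν`) + mixed graded + `Ct·`tail (in `Bμ`), divided by `u^p·K`, is T2-Lip's `hstep` right side in `bν, bμ` with the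
  rescaled constants (E1's `kitFO_units` on the difference profile, `kitTail_units` on the majorant).
Pure real analysis; nothing about the model is asserted.
-/

noncomputable section

namespace Summit.HubbardSuperconductivity.HubbardSuperconductivity.Theorems.EngineV8

set_option linter.dupNamespace false -- summit = problem name (single-conjunct summit), D-0017

open Real Finset

/-- Linearity of `towerSLip` in a COMMON constant factor of both profiles: `towerSLip D τ (K·ν) (K·μ) n p = Kⁿ · towerSLip D τ ν μ n p`. -/
theorem towerSLip_const_mul (D : ℕ) (τ K : ℝ) (ν μ : ℕ → ℝ) (n p : ℕ) :
    towerSLip D τ (fun m => K * ν m) (fun m => K * μ m) n p = K ^ n * towerSLip D τ ν μ n p := by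
  unfold towerSLip
  rw [mul_sum]
  refine sum_congr rfl fun δ _ => ?_
  rw [mul_sum]
  refine sum_congr rfl fun a _ => ?_
  dsimp only
  have h1 : ∏ a' ∈ univ.erase a, τ ^ δ a' * (K * μ (δ a')) = (∏ _a' ∈ univ.erase a, K) * ∏ a' ∈ univ.erase a, τ ^ δ a' * μ (δ a') := by
    rw [← prod_mul_distrib]
    exact prod_congr rfl fun b _ => by ring
  obtain ⟨k, hk⟩ : ∃ k, n = k + 1 := ⟨n - 1, by have := a.isLt; omega⟩
  have hKn : K ^ n = K * K ^ k := by rw [hk, pow_succ, mul_comm]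
  rw [h1, prod_const, card_erase_of_mem (mem_univ a), card_univ, Fintype.card_fin, show n - 1 = k by omega, hKn]
  ring

/-- `towerSLip` in absolute sizes `Bν = K·u^m·bν`, `Bμ = K·u^m·bμ`: `towerSLip D τ Bν Bμ n p = Kⁿ · towerSLip D (τu) bν bμ n p`. -/
theorem towerSLip_units (D : ℕ) (τ K u : ℝ) (bν bμ : ℕ → ℝ) (n p : ℕ) :
    towerSLip D τ (fun m => K * (u ^ m * bν m)) (fun m => K * (u ^ m * bμ m)) n p = K ^ n * towerSLip D (τ * u) bν bμ n p := by
  rw [towerSLip_const_mul, towerSLip_pow_mul]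

/-- **UNITS IN THE MIXED GRADED PART**: dividing by the output unit `u^p·K` rescales `Φ ↦ Φ·K`, `ψ ↦ ψ/u`, `τ ↦ τ·u` (orders `n ≥ 1`). -/
theorem kitGradedLip_units {K u : ℝ} (hK : K ≠ 0) (hu : u ≠ 0) (D : ℕ) (τ Φ ψ : ℝ) (bν bμ : ℕ → ℝ) (N p : ℕ) :
    (∑ n ∈ Icc 2 N, exp 1 * Φ ^ (n - 1) * ψ ^ p *
        towerSLip D τ (fun m => K * (u ^ m * bν m)) (fun m => K * (u ^ m * bμ m)) n p) / (u ^ p * K) =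
      ∑ n ∈ Icc 2 N, exp 1 * (Φ * K) ^ (n - 1) * (ψ / u) ^ p * towerSLip D (τ * u) bν bμ n p := by
  rw [sum_div]
  refine sum_congr rfl fun n hn => ?_
  have hn1 : 1 ≤ n := by have := (mem_Icc.1 hn).1; omega
  rw [towerSLip_units]
  obtain ⟨k, rfl⟩ : ∃ k, n = k + 1 := ⟨n - 1, by omega⟩
  rw [Nat.add_sub_cancel, pow_succ, mul_pow, div_pow]
  have hup : u ^ p ≠ 0 := pow_ne_zero _ hu
  field_simp

/-- **THE WHOLE LIPSCHITZ STEP RIGHT SIDE IN UNITS**: first order in the difference sizes `Bν` + mixed graded + `Ct·`tail in the majorant `Bμ`, divided by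
`u^p·K`, is T2-Lip's `hstep` right side in the dimensionless sizes `bν, bμ` with `(σ̂, τ̂, Φ̂, ψ̂) = (σu, τu, ΦK, ψ/u)` (the source `src` is divided by the
caller). -/
theorem kitStepLip_units {K u : ℝ} (hK : K ≠ 0) (hu : u ≠ 0) (D : ℕ) (σ τ Φ ψ Ct : ℝ) (bν bμ : ℕ → ℝ) (N p : ℕ) :
    (towerFO D σ (fun m => K * (u ^ m * bν m)) p +
        ∑ n ∈ Icc 2 N, exp 1 * Φ ^ (n - 1) * ψ ^ p *
          towerSLip D τ (fun m => K * (u ^ m * bν m)) (fun m => K * (u ^ m * bμ m)) n p +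
        Ct * (ψ ^ p * exp 1 * towerV D τ (fun m => K * (u ^ m * bμ m)) * (Φ * towerV D τ (fun m => K * (u ^ m * bμ m))) ^ N /
          (1 - Φ * towerV D τ (fun m => K * (u ^ m * bμ m))))) / (u ^ p * K) =
      towerFO D (σ * u) bν p + ∑ n ∈ Icc 2 N, exp 1 * (Φ * K) ^ (n - 1) * (ψ / u) ^ p * towerSLip D (τ * u) bν bμ n p +
        Ct * ((ψ / u) ^ p * exp 1 * towerV D (τ * u) bμ * (Φ * K * towerV D (τ * u) bμ) ^ N / (1 - Φ * K * towerV D (τ * u) bμ)) := by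
  rw [add_div, add_div, kitFO_units hK hu, kitGradedLip_units hK hu, mul_div_assoc, kitTail_units hK hu]

end Summit.HubbardSuperconductivity.HubbardSuperconductivity.Theorems.EngineV8

end
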